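import Mathlib
import Literature.Probability.LatticeModels.ScalingLimit
import Summits.CriticalPhenomena.Ising3DConformalLimit.Theorems.PrecisionLaplacianMoebiusLimitOfTwoPointLawMultipoleToWardOfContinuousAux
import HarnessLib

/-!
# Helpers for stub S5b `stub_multipoleToWardOfContinuous` (line `multipole-ward-nonsat-endpoint`,
crux `MoebiusLimitOfTwoPointLaw`, item stmt-CriticalPhenomena-4801), part 2: the key identity

`mtw_key_identity`: testing the first-multipole identity of level `n+1` (monopole coefficient `A₀`,
dipole coefficient `A₁`) with the product test function `ψ(w) = φ(init w) g(w last)` (`g` even),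
and subtracting the separable main terms (which are computed by separation of variables and killed
by oddness of `z ↦ ⟪z,b⟫ g(z)` and of `z ↦ (2Δ-6)⟪b,z⟫ g(z) + Dg(z)[‖z‖²b − 2⟪b,z⟫z]`), one gets

`c (∫ g) · W(φ) = ∫ (⟪r₁, b⟫ φ g − r₀ · B)`,

where `W(φ) = ∫ Sₙ [(2Δ−6)(Σᵢ⟪b,xᵢ⟫) φ + Dφ[V]]` is the weak special-conformal Ward functional,
`r₀ = A₀ − c Sₙ(init ·)`, `r₁ = A₁ − 2Δc Sₙ(init ·) (· last)` are the clustering remainders and `B`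
is the bracket `(2Δ−6)(Σ⟪b,xᵢ⟫ + ⟪b,z⟫) φ g + g Dφ[V] + φ Dg[v]`.
-/

noncomputable section

namespace Summit.CriticalPhenomena.Ising3DConformalLimit.PrecisionLaplacianMoebiusLimitOfTwoPointLaw

open Literature.Probability.LatticeModels Filter Topology MeasureTheory
open Summit.CriticalPhenomena.Ising3DConformalLimit.Theorems.PrimaryAtInfinityMultipoleToWard

/-- The special-conformal vector field is even: `v(-z) = v(z)` for `v(z) = ‖z‖² b − 2⟪b,z⟫ z`. -/
theorem mtw_sctField_neg (b z : EuclideanSpace ℝ (Fin 3)) :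
    ‖-z‖ ^ 2 • b - (2 * inner ℝ b (-z)) • (-z) = ‖z‖ ^ 2 • b - (2 * inner ℝ b z) • z := by
  rw [norm_neg, inner_neg_right, mul_neg, neg_smul, smul_neg, neg_neg]

/-- **Key identity.** The first-multipole identity tested against `ψ(w) = φ(init w) g(w last)` with
`g` even, minus its separable main terms: `c (∫ g) W(φ) = ∫ (⟪r₁, b⟫ φ g − r₀ B)`. -/
theorem mtw_key_identity :
    ∀ (n : ℕ) (b : EuclideanSpace ℝ (Fin 3)) (Δ c : ℝ) (Sn : (Fin n → EuclideanSpace ℝ (Fin 3)) → ℝ)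
      (A₀ : (Fin (n + 1) → EuclideanSpace ℝ (Fin 3)) → ℝ)
      (A₁ : (Fin (n + 1) → EuclideanSpace ℝ (Fin 3)) → EuclideanSpace ℝ (Fin 3))
      (φ : (Fin n → EuclideanSpace ℝ (Fin 3)) → ℝ) (g : EuclideanSpace ℝ (Fin 3) → ℝ),
      ContinuousOn Sn (NonCoincident 3 n) → ContinuousOn A₀ (NonCoincident 3 (n + 1)) →
      ContinuousOn A₁ (NonCoincident 3 (n + 1)) →
      ContDiff ℝ ((⊤ : ℕ∞) : WithTop ℕ∞) φ → HasCompactSupport φ → tsupport φ ⊆ NonCoincident 3 n →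
      ContDiff ℝ ((⊤ : ℕ∞) : WithTop ℕ∞) g → HasCompactSupport g → (∀ z, g (-z) = g z) →
      (∀ x ∈ tsupport φ, ∀ z ∈ tsupport g, ∀ i, x i ≠ z) →
      (∫ w : Fin (n + 1) → EuclideanSpace ℝ (Fin 3),
          inner ℝ (A₁ w) b * (φ (Fin.init w) * g (w (Fin.last n))) =
        ∫ w : Fin (n + 1) → EuclideanSpace ℝ (Fin 3), A₀ w *
          ((2 * Δ - 6) * (∑ i, inner ℝ b (w i)) * (φ (Fin.init w) * g (w (Fin.last n))) +
            fderiv ℝ (fun w : Fin (n + 1) → EuclideanSpace ℝ (Fin 3) =>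
              φ (Fin.init w) * g (w (Fin.last n))) w
              (fun i => ‖w i‖ ^ 2 • b - (2 * inner ℝ b (w i)) • w i))) →
      c * (∫ z, g z) * (∫ x, Sn x * ((2 * Δ - 6) * (∑ i, inner ℝ b (x i)) * φ x +
          fderiv ℝ φ x (fun i => ‖x i‖ ^ 2 • b - (2 * inner ℝ b (x i)) • x i))) =
        ∫ w : Fin (n + 1) → EuclideanSpace ℝ (Fin 3),
          (inner ℝ (A₁ w - (2 * Δ * c * Sn (Fin.init w)) • w (Fin.last n)) b *
              (φ (Fin.init w) * g (w (Fin.last n))) -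
            (A₀ w - c * Sn (Fin.init w)) *
              ((2 * Δ - 6) * ((∑ i, inner ℝ b (Fin.init w i)) + inner ℝ b (w (Fin.last n))) *
                  (φ (Fin.init w) * g (w (Fin.last n))) +
                (g (w (Fin.last n)) * fderiv ℝ φ (Fin.init w)
                    (fun i => ‖Fin.init w i‖ ^ 2 • b - (2 * inner ℝ b (Fin.init w i)) • Fin.init w i) +
                  φ (Fin.init w) * fderiv ℝ g (w (Fin.last n))
                    (‖w (Fin.last n)‖ ^ 2 • b -
                      (2 * inner ℝ b (w (Fin.last n))) • w (Fin.last n))))) := by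
  intro n b Δ c Sn A₀ A₁ φ g hSn hA₀ hA₁ hφ hφc hφs hg hgc hge hsep hI
  -- basic facts
  have hK'U := mtw_setOf_subset_nonCoincident hφs hsep
  have hφd : Differentiable ℝ φ := hφ.differentiable (by simp)
  have hgd : Differentiable ℝ g := hg.differentiable (by simp)
  have hφ0 : Continuous φ := hφ.continuous
  have hg0 : Continuous g := hg.continuous
  have hφ1 : Continuous (fderiv ℝ φ) := hφ.continuous_fderiv (by simp)
  have hg1 : Continuous (fderiv ℝ g) := hg.continuous_fderiv (by simp)
  have vφ : ∀ x, x ∉ tsupport φ → φ x = 0 := fun x hx => image_eq_zero_of_notMem_tsupport hx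
  have vφ' : ∀ x, x ∉ tsupport φ → fderiv ℝ φ x = 0 := fun x hx => fderiv_of_notMem_tsupport ℝ hx
  have vg : ∀ z, z ∉ tsupport g → g z = 0 := fun z hz => image_eq_zero_of_notMem_tsupport hz
  have vg' : ∀ z, z ∉ tsupport g → fderiv ℝ g z = 0 := fun z hz => fderiv_of_notMem_tsupport ℝ hz
  have hci : Continuous fun w : Fin (n + 1) → EuclideanSpace ℝ (Fin 3) =>
      (Fin.init w : Fin n → EuclideanSpace ℝ (Fin 3)) := continuous_id.finInit
  have hSn' : ContinuousOn (fun w : Fin (n + 1) → EuclideanSpace ℝ (Fin 3) => Sn (Fin.init w))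
      ((fun w : Fin (n + 1) → EuclideanSpace ℝ (Fin 3) => (Fin.init w : Fin n → EuclideanSpace ℝ (Fin 3)))
        ⁻¹' NonCoincident 3 n) :=
    hSn.comp hci.continuousOn fun w hw => hw
  have hK'U' : {w : Fin (n + 1) → EuclideanSpace ℝ (Fin 3) |
      Fin.init w ∈ tsupport φ ∧ w (Fin.last n) ∈ tsupport g} ⊆
      (fun w : Fin (n + 1) → EuclideanSpace ℝ (Fin 3) =>
        (Fin.init w : Fin n → EuclideanSpace ℝ (Fin 3))) ⁻¹' NonCoincident 3 n := fun w hw => hφs hw.1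
  -- (1) the test function `ψ₀ = φ(init) g(last)` and `T1 = ⟪A₁, b⟫ ψ₀`
  have hψ0c : Continuous fun w : Fin (n + 1) → EuclideanSpace ℝ (Fin 3) =>
      φ (Fin.init w) * g (w (Fin.last n)) := by fun_prop
  obtain ⟨hψ0cs, hψ0ts⟩ := mtw_hasCompactSupport_of_vanish hφc hgc
    (θ := fun w : Fin (n + 1) → EuclideanSpace ℝ (Fin 3) => φ (Fin.init w) * g (w (Fin.last n)))
    (fun w hw => by simp only [vφ _ hw, zero_mul]) (fun w hw => by simp only [vg _ hw, mul_zero])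
  have hT1 : Integrable fun w : Fin (n + 1) → EuclideanSpace ℝ (Fin 3) =>
      inner ℝ (A₁ w) b * (φ (Fin.init w) * g (w (Fin.last n))) :=
    integrable_mul_of_continuousOn_tsupport hψ0c hψ0cs
      ((hA₁.inner continuousOn_const).mono (hψ0ts.trans hK'U))
  -- (2) the separable dipole main term `T2 = Sₙ φ · ⟪z, b⟫ g`, which integrates to zero
  have hSφ : Integrable fun x : Fin n → EuclideanSpace ℝ (Fin 3) => Sn x * φ x :=
    integrable_mul_of_continuousOn_tsupport hφ0 hφc (hSn.mono hφs)
  have hG1c : Continuous fun z : EuclideanSpace ℝ (Fin 3) => inner ℝ z b * g z := by fun_prop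
  have hG1 : Integrable fun z : EuclideanSpace ℝ (Fin 3) => inner ℝ z b * g z :=
    hG1c.integrable_of_hasCompactSupport hgc.mul_left
  have hT2 : Integrable fun w : Fin (n + 1) → EuclideanSpace ℝ (Fin 3) =>
      (Sn (Fin.init w) * φ (Fin.init w)) * (inner ℝ (w (Fin.last n)) b * g (w (Fin.last n))) :=
    mtw_integrable_init_mul_last (F := fun x => Sn x * φ x) (G := fun z => inner ℝ z b * g z) hSφ hG1
  have hT2v : ∫ w : Fin (n + 1) → EuclideanSpace ℝ (Fin 3),
      (Sn (Fin.init w) * φ (Fin.init w)) * (inner ℝ (w (Fin.last n)) b * g (w (Fin.last n))) = 0 := by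
    rw [mtw_integral_init_mul_last n (fun x => Sn x * φ x) (fun z => inner ℝ z b * g z),
      integral_eq_zero_of_odd (f := fun z => inner ℝ z b * g z)
        (fun z => by rw [inner_neg_left, hge, neg_mul]), mul_zero]
  -- (3) the bracket `B` and `T3 = A₀ B`, `T4 = Sₙ(init) B`
  have hBc : Continuous fun w : Fin (n + 1) → EuclideanSpace ℝ (Fin 3) =>
      (2 * Δ - 6) * ((∑ i, inner ℝ b (Fin.init w i)) + inner ℝ b (w (Fin.last n))) *
          (φ (Fin.init w) * g (w (Fin.last n))) +
        (g (w (Fin.last n)) * fderiv ℝ φ (Fin.init w)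
            (fun i => ‖Fin.init w i‖ ^ 2 • b - (2 * inner ℝ b (Fin.init w i)) • Fin.init w i) +
          φ (Fin.init w) * fderiv ℝ g (w (Fin.last n))
            (‖w (Fin.last n)‖ ^ 2 • b - (2 * inner ℝ b (w (Fin.last n))) • w (Fin.last n))) := by
    fun_prop
  obtain ⟨hBcs, hBts⟩ := mtw_hasCompactSupport_of_vanish hφc hgc
    (θ := fun w : Fin (n + 1) → EuclideanSpace ℝ (Fin 3) =>
      (2 * Δ - 6) * ((∑ i, inner ℝ b (Fin.init w i)) + inner ℝ b (w (Fin.last n))) *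
          (φ (Fin.init w) * g (w (Fin.last n))) +
        (g (w (Fin.last n)) * fderiv ℝ φ (Fin.init w)
            (fun i => ‖Fin.init w i‖ ^ 2 • b - (2 * inner ℝ b (Fin.init w i)) • Fin.init w i) +
          φ (Fin.init w) * fderiv ℝ g (w (Fin.last n))
            (‖w (Fin.last n)‖ ^ 2 • b - (2 * inner ℝ b (w (Fin.last n))) • w (Fin.last n))))
    (fun w hw => by
      simp only [vφ _ hw, vφ' _ hw, zero_apply, mul_zero, zero_mul, add_zero])
    (fun w hw => by
      simp only [vg _ hw, vg' _ hw, zero_apply, mul_zero, zero_mul, add_zero])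
  have hT3 : Integrable fun w : Fin (n + 1) → EuclideanSpace ℝ (Fin 3) => A₀ w *
      ((2 * Δ - 6) * ((∑ i, inner ℝ b (Fin.init w i)) + inner ℝ b (w (Fin.last n))) *
          (φ (Fin.init w) * g (w (Fin.last n))) +
        (g (w (Fin.last n)) * fderiv ℝ φ (Fin.init w)
            (fun i => ‖Fin.init w i‖ ^ 2 • b - (2 * inner ℝ b (Fin.init w i)) • Fin.init w i) +
          φ (Fin.init w) * fderiv ℝ g (w (Fin.last n))
            (‖w (Fin.last n)‖ ^ 2 • b - (2 * inner ℝ b (w (Fin.last n))) • w (Fin.last n)))) :=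
    integrable_mul_of_continuousOn_tsupport hBc hBcs (hA₀.mono (hBts.trans hK'U))
  have hT4 : Integrable fun w : Fin (n + 1) → EuclideanSpace ℝ (Fin 3) => Sn (Fin.init w) *
      ((2 * Δ - 6) * ((∑ i, inner ℝ b (Fin.init w i)) + inner ℝ b (w (Fin.last n))) *
          (φ (Fin.init w) * g (w (Fin.last n))) +
        (g (w (Fin.last n)) * fderiv ℝ φ (Fin.init w)
            (fun i => ‖Fin.init w i‖ ^ 2 • b - (2 * inner ℝ b (Fin.init w i)) • Fin.init w i) +
          φ (Fin.init w) * fderiv ℝ g (w (Fin.last n))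
            (‖w (Fin.last n)‖ ^ 2 • b - (2 * inner ℝ b (w (Fin.last n))) • w (Fin.last n)))) :=
    integrable_mul_of_continuousOn_tsupport hBc hBcs (hSn'.mono (hBts.trans hK'U'))
  -- (4) the Ward main term `T4a = (Sₙ θ₁)(init) · g(last)`
  have hθ1c : Continuous fun x : Fin n → EuclideanSpace ℝ (Fin 3) =>
      (2 * Δ - 6) * (∑ i, inner ℝ b (x i)) * φ x +
        fderiv ℝ φ x (fun i => ‖x i‖ ^ 2 • b - (2 * inner ℝ b (x i)) • x i) := by fun_prop
  have hθ1s : Function.support (fun x : Fin n → EuclideanSpace ℝ (Fin 3) =>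
      (2 * Δ - 6) * (∑ i, inner ℝ b (x i)) * φ x +
        fderiv ℝ φ x (fun i => ‖x i‖ ^ 2 • b - (2 * inner ℝ b (x i)) • x i)) ⊆ tsupport φ := by
    intro x hx
    by_contra h
    exact hx (by simp only [vφ _ h, vφ' _ h, zero_apply, mul_zero, add_zero])
  have hWi : Integrable fun x : Fin n → EuclideanSpace ℝ (Fin 3) => Sn x *
      ((2 * Δ - 6) * (∑ i, inner ℝ b (x i)) * φ x +
        fderiv ℝ φ x (fun i => ‖x i‖ ^ 2 • b - (2 * inner ℝ b (x i)) • x i)) :=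
    integrable_mul_of_continuousOn_tsupport hθ1c
      (HasCompactSupport.of_support_subset_isCompact hφc.isCompact hθ1s)
      (hSn.mono ((closure_minimal hθ1s (isClosed_tsupport φ)).trans hφs))
  have hgi : Integrable g := hg0.integrable_of_hasCompactSupport hgc
  have hT4a : Integrable fun w : Fin (n + 1) → EuclideanSpace ℝ (Fin 3) =>
      (Sn (Fin.init w) * ((2 * Δ - 6) * (∑ i, inner ℝ b (Fin.init w i)) * φ (Fin.init w) +
        fderiv ℝ φ (Fin.init w)
          (fun i => ‖Fin.init w i‖ ^ 2 • b - (2 * inner ℝ b (Fin.init w i)) • Fin.init w i))) *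
        g (w (Fin.last n)) :=
    mtw_integrable_init_mul_last (F := fun x : Fin n → EuclideanSpace ℝ (Fin 3) => Sn x *
      ((2 * Δ - 6) * (∑ i, inner ℝ b (x i)) * φ x +
        fderiv ℝ φ x (fun i => ‖x i‖ ^ 2 • b - (2 * inner ℝ b (x i)) • x i))) (G := g) hWi hgi
  have hT4av : ∫ w : Fin (n + 1) → EuclideanSpace ℝ (Fin 3),
      (Sn (Fin.init w) * ((2 * Δ - 6) * (∑ i, inner ℝ b (Fin.init w i)) * φ (Fin.init w) +
        fderiv ℝ φ (Fin.init w)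
          (fun i => ‖Fin.init w i‖ ^ 2 • b - (2 * inner ℝ b (Fin.init w i)) • Fin.init w i))) *
        g (w (Fin.last n)) =
      (∫ x, Sn x * ((2 * Δ - 6) * (∑ i, inner ℝ b (x i)) * φ x +
          fderiv ℝ φ x (fun i => ‖x i‖ ^ 2 • b - (2 * inner ℝ b (x i)) • x i))) * ∫ z, g z :=
    mtw_integral_init_mul_last n (fun x : Fin n → EuclideanSpace ℝ (Fin 3) => Sn x *
      ((2 * Δ - 6) * (∑ i, inner ℝ b (x i)) * φ x +
        fderiv ℝ φ x (fun i => ‖x i‖ ^ 2 • b - (2 * inner ℝ b (x i)) • x i))) g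
  -- (5) the separable monopole main term `T4b = (Sₙ φ)(init) · G₂(last)`, `G₂` odd
  have hG2c : Continuous fun z : EuclideanSpace ℝ (Fin 3) =>
      (2 * Δ - 6) * inner ℝ b z * g z + fderiv ℝ g z (‖z‖ ^ 2 • b - (2 * inner ℝ b z) • z) := by
    fun_prop
  have hG2s : Function.support (fun z : EuclideanSpace ℝ (Fin 3) =>
      (2 * Δ - 6) * inner ℝ b z * g z + fderiv ℝ g z (‖z‖ ^ 2 • b - (2 * inner ℝ b z) • z)) ⊆
      tsupport g := by
    intro z hz
    by_contra h
    exact hz (by simp only [vg _ h, vg' _ h, zero_apply, mul_zero, add_zero])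
  have hG2i : Integrable fun z : EuclideanSpace ℝ (Fin 3) =>
      (2 * Δ - 6) * inner ℝ b z * g z + fderiv ℝ g z (‖z‖ ^ 2 • b - (2 * inner ℝ b z) • z) :=
    hG2c.integrable_of_hasCompactSupport
      (HasCompactSupport.of_support_subset_isCompact hgc.isCompact hG2s)
  have hG2odd : ∀ z : EuclideanSpace ℝ (Fin 3),
      (2 * Δ - 6) * inner ℝ b (-z) * g (-z) +
          fderiv ℝ g (-z) (‖-z‖ ^ 2 • b - (2 * inner ℝ b (-z)) • (-z)) =
        -((2 * Δ - 6) * inner ℝ b z * g z + fderiv ℝ g z (‖z‖ ^ 2 • b - (2 * inner ℝ b z) • z)) := by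
    intro z
    rw [mtw_sctField_neg, mtw_fderiv_neg_of_even hge, inner_neg_right, hge]
    ring
  have hT4b : Integrable fun w : Fin (n + 1) → EuclideanSpace ℝ (Fin 3) =>
      (Sn (Fin.init w) * φ (Fin.init w)) *
        ((2 * Δ - 6) * inner ℝ b (w (Fin.last n)) * g (w (Fin.last n)) +
          fderiv ℝ g (w (Fin.last n))
            (‖w (Fin.last n)‖ ^ 2 • b - (2 * inner ℝ b (w (Fin.last n))) • w (Fin.last n))) :=
    mtw_integrable_init_mul_last (F := fun x => Sn x * φ x) (G := fun z : EuclideanSpace ℝ (Fin 3) =>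
      (2 * Δ - 6) * inner ℝ b z * g z + fderiv ℝ g z (‖z‖ ^ 2 • b - (2 * inner ℝ b z) • z)) hSφ hG2i
  have hT4bv : ∫ w : Fin (n + 1) → EuclideanSpace ℝ (Fin 3),
      (Sn (Fin.init w) * φ (Fin.init w)) *
        ((2 * Δ - 6) * inner ℝ b (w (Fin.last n)) * g (w (Fin.last n)) +
          fderiv ℝ g (w (Fin.last n))
            (‖w (Fin.last n)‖ ^ 2 • b - (2 * inner ℝ b (w (Fin.last n))) • w (Fin.last n))) = 0 := by
    rw [mtw_integral_init_mul_last n (fun x => Sn x * φ x) (fun z : EuclideanSpace ℝ (Fin 3) =>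
      (2 * Δ - 6) * inner ℝ b z * g z + fderiv ℝ g z (‖z‖ ^ 2 • b - (2 * inner ℝ b z) • z)),
      integral_eq_zero_of_odd hG2odd, mul_zero]
  -- (6) the tested identity, with `Dψ` and the sum over `Fin (n+1)` expanded
  have hI' : ∫ w : Fin (n + 1) → EuclideanSpace ℝ (Fin 3),
      inner ℝ (A₁ w) b * (φ (Fin.init w) * g (w (Fin.last n))) =
      ∫ w : Fin (n + 1) → EuclideanSpace ℝ (Fin 3), A₀ w *
        ((2 * Δ - 6) * ((∑ i, inner ℝ b (Fin.init w i)) + inner ℝ b (w (Fin.last n))) *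
            (φ (Fin.init w) * g (w (Fin.last n))) +
          (g (w (Fin.last n)) * fderiv ℝ φ (Fin.init w)
              (fun i => ‖Fin.init w i‖ ^ 2 • b - (2 * inner ℝ b (Fin.init w i)) • Fin.init w i) +
            φ (Fin.init w) * fderiv ℝ g (w (Fin.last n))
              (‖w (Fin.last n)‖ ^ 2 • b - (2 * inner ℝ b (w (Fin.last n))) • w (Fin.last n)))) := by
    rw [hI]
    congr 1
    funext w
    rw [mtw_fderiv_psi hφd hgd, Fin.sum_univ_castSucc]
    rfl
  -- (7) `∫ T4 = W · ∫ g`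
  have hT4v : ∫ w : Fin (n + 1) → EuclideanSpace ℝ (Fin 3), Sn (Fin.init w) *
      ((2 * Δ - 6) * ((∑ i, inner ℝ b (Fin.init w i)) + inner ℝ b (w (Fin.last n))) *
          (φ (Fin.init w) * g (w (Fin.last n))) +
        (g (w (Fin.last n)) * fderiv ℝ φ (Fin.init w)
            (fun i => ‖Fin.init w i‖ ^ 2 • b - (2 * inner ℝ b (Fin.init w i)) • Fin.init w i) +
          φ (Fin.init w) * fderiv ℝ g (w (Fin.last n))
            (‖w (Fin.last n)‖ ^ 2 • b - (2 * inner ℝ b (w (Fin.last n))) • w (Fin.last n)))) =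
      (∫ x, Sn x * ((2 * Δ - 6) * (∑ i, inner ℝ b (x i)) * φ x +
          fderiv ℝ φ x (fun i => ‖x i‖ ^ 2 • b - (2 * inner ℝ b (x i)) • x i))) * ∫ z, g z := by
    have h : (fun w : Fin (n + 1) → EuclideanSpace ℝ (Fin 3) => Sn (Fin.init w) *
      ((2 * Δ - 6) * ((∑ i, inner ℝ b (Fin.init w i)) + inner ℝ b (w (Fin.last n))) *
          (φ (Fin.init w) * g (w (Fin.last n))) +
        (g (w (Fin.last n)) * fderiv ℝ φ (Fin.init w)
            (fun i => ‖Fin.init w i‖ ^ 2 • b - (2 * inner ℝ b (Fin.init w i)) • Fin.init w i) +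
          φ (Fin.init w) * fderiv ℝ g (w (Fin.last n))
            (‖w (Fin.last n)‖ ^ 2 • b - (2 * inner ℝ b (w (Fin.last n))) • w (Fin.last n))))) =
      fun w => (Sn (Fin.init w) * ((2 * Δ - 6) * (∑ i, inner ℝ b (Fin.init w i)) * φ (Fin.init w) +
        fderiv ℝ φ (Fin.init w)
          (fun i => ‖Fin.init w i‖ ^ 2 • b - (2 * inner ℝ b (Fin.init w i)) • Fin.init w i))) *
        g (w (Fin.last n)) +
      (Sn (Fin.init w) * φ (Fin.init w)) *
        ((2 * Δ - 6) * inner ℝ b (w (Fin.last n)) * g (w (Fin.last n)) +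
          fderiv ℝ g (w (Fin.last n))
            (‖w (Fin.last n)‖ ^ 2 • b - (2 * inner ℝ b (w (Fin.last n))) • w (Fin.last n))) := by
      funext w; ring
    rw [h, integral_add hT4a hT4b, hT4av, hT4bv, add_zero]
  -- (8) pointwise decomposition of the remainder integrand and conclusion
  have hI12 : Integrable fun w : Fin (n + 1) → EuclideanSpace ℝ (Fin 3) =>
      inner ℝ (A₁ w) b * (φ (Fin.init w) * g (w (Fin.last n))) -
        (2 * Δ * c) * ((Sn (Fin.init w) * φ (Fin.init w)) *
          (inner ℝ (w (Fin.last n)) b * g (w (Fin.last n)))) := hT1.sub (hT2.const_mul _)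
  have hI2 : Integrable fun w : Fin (n + 1) → EuclideanSpace ℝ (Fin 3) =>
      (2 * Δ * c) * ((Sn (Fin.init w) * φ (Fin.init w)) *
        (inner ℝ (w (Fin.last n)) b * g (w (Fin.last n)))) := hT2.const_mul _
  have hI123 : Integrable fun w : Fin (n + 1) → EuclideanSpace ℝ (Fin 3) =>
      inner ℝ (A₁ w) b * (φ (Fin.init w) * g (w (Fin.last n))) -
        (2 * Δ * c) * ((Sn (Fin.init w) * φ (Fin.init w)) *
          (inner ℝ (w (Fin.last n)) b * g (w (Fin.last n)))) - A₀ w *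
      ((2 * Δ - 6) * ((∑ i, inner ℝ b (Fin.init w i)) + inner ℝ b (w (Fin.last n))) *
          (φ (Fin.init w) * g (w (Fin.last n))) +
        (g (w (Fin.last n)) * fderiv ℝ φ (Fin.init w)
            (fun i => ‖Fin.init w i‖ ^ 2 • b - (2 * inner ℝ b (Fin.init w i)) • Fin.init w i) +
          φ (Fin.init w) * fderiv ℝ g (w (Fin.last n))
            (‖w (Fin.last n)‖ ^ 2 • b - (2 * inner ℝ b (w (Fin.last n))) • w (Fin.last n)))) :=
    hI12.sub hT3
  have hI4 : Integrable fun w : Fin (n + 1) → EuclideanSpace ℝ (Fin 3) => c * (Sn (Fin.init w) *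
      ((2 * Δ - 6) * ((∑ i, inner ℝ b (Fin.init w i)) + inner ℝ b (w (Fin.last n))) *
          (φ (Fin.init w) * g (w (Fin.last n))) +
        (g (w (Fin.last n)) * fderiv ℝ φ (Fin.init w)
            (fun i => ‖Fin.init w i‖ ^ 2 • b - (2 * inner ℝ b (Fin.init w i)) • Fin.init w i) +
          φ (Fin.init w) * fderiv ℝ g (w (Fin.last n))
            (‖w (Fin.last n)‖ ^ 2 • b - (2 * inner ℝ b (w (Fin.last n))) • w (Fin.last n))))) :=
    hT4.const_mul c
  have hpt : (fun w : Fin (n + 1) → EuclideanSpace ℝ (Fin 3) =>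
      inner ℝ (A₁ w - (2 * Δ * c * Sn (Fin.init w)) • w (Fin.last n)) b *
          (φ (Fin.init w) * g (w (Fin.last n))) -
        (A₀ w - c * Sn (Fin.init w)) *
          ((2 * Δ - 6) * ((∑ i, inner ℝ b (Fin.init w i)) + inner ℝ b (w (Fin.last n))) *
              (φ (Fin.init w) * g (w (Fin.last n))) +
            (g (w (Fin.last n)) * fderiv ℝ φ (Fin.init w)
                (fun i => ‖Fin.init w i‖ ^ 2 • b - (2 * inner ℝ b (Fin.init w i)) • Fin.init w i) +
              φ (Fin.init w) * fderiv ℝ g (w (Fin.last n))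
                (‖w (Fin.last n)‖ ^ 2 • b - (2 * inner ℝ b (w (Fin.last n))) • w (Fin.last n))))) =
      fun w => inner ℝ (A₁ w) b * (φ (Fin.init w) * g (w (Fin.last n))) -
        (2 * Δ * c) * ((Sn (Fin.init w) * φ (Fin.init w)) *
          (inner ℝ (w (Fin.last n)) b * g (w (Fin.last n)))) - A₀ w *
      ((2 * Δ - 6) * ((∑ i, inner ℝ b (Fin.init w i)) + inner ℝ b (w (Fin.last n))) *
          (φ (Fin.init w) * g (w (Fin.last n))) +
        (g (w (Fin.last n)) * fderiv ℝ φ (Fin.init w)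
            (fun i => ‖Fin.init w i‖ ^ 2 • b - (2 * inner ℝ b (Fin.init w i)) • Fin.init w i) +
          φ (Fin.init w) * fderiv ℝ g (w (Fin.last n))
            (‖w (Fin.last n)‖ ^ 2 • b - (2 * inner ℝ b (w (Fin.last n))) • w (Fin.last n)))) +
      c * (Sn (Fin.init w) *
      ((2 * Δ - 6) * ((∑ i, inner ℝ b (Fin.init w i)) + inner ℝ b (w (Fin.last n))) *
          (φ (Fin.init w) * g (w (Fin.last n))) +
        (g (w (Fin.last n)) * fderiv ℝ φ (Fin.init w)
            (fun i => ‖Fin.init w i‖ ^ 2 • b - (2 * inner ℝ b (Fin.init w i)) • Fin.init w i) +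
          φ (Fin.init w) * fderiv ℝ g (w (Fin.last n))
            (‖w (Fin.last n)‖ ^ 2 • b - (2 * inner ℝ b (w (Fin.last n))) • w (Fin.last n))))) := by
    funext w
    rw [inner_sub_left, real_inner_smul_left]
    ring
  rw [hpt, integral_add hI123 hI4, integral_sub hI12 hT3, integral_sub hT1 hI2, integral_const_mul,
    integral_const_mul, hT2v, hI', hT4v]
  ring

end Summit.CriticalPhenomena.Ising3DConformalLimit.PrecisionLaplacianMoebiusLimitOfTwoPointLaw
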